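import Literature.Algebra.Lie.ChevalleyEilenbergDirectSum
import Literature.Algebra.Lie.ChevalleyEilenbergBigrading
import HarnessLib

/-!
# Twisted functoriality of the relative and `(𝔤, K)`-complexes: change of Lie pair along an
# automorphism of `(𝔤, K)` (Borel–Wallach I §1.1, §5.1)

Topic `Algebra/Lie`; namespace `Literature.Algebra.Lie.ChevalleyEilenberg` (continues
`ChevalleyEilenbergFunctoriality`: `pull φ ψ`, `Compatible`, `d_pull`, `PairAction`, `Subcomplex.gK`,
`Subcomplex.IsCochainMapTo`; `ChevalleyEilenbergDirectSum`: `IsCochainMapTo.cohomologyEquiv`;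
`ChevalleyEilenbergBigrading`: `argDer`, `weightSub`, `typeSub`).  Theorems and one definition with body;
no named fact, no `sorry`.

A. Borel, N. Wallach (2000), I §1.1 [BorelWallach2000]: the cochain complex `C^q(𝔤; V) = Hom_F(Λ^q 𝔤, V)`
is functorial in the PAIR `(𝔤, V)` — a Lie algebra morphism `φ : 𝔤' → 𝔤` and an `F`-linear `ψ : V → V'`
with `ψ(φ(x')·v) = x'·ψ(v)` induce `f ↦ ψ ∘ f ∘ Λ^q φ` commuting with `d`; I §5.1 (1)–(4): the
`(𝔤, K)`-complex `C^q(𝔤, K; V) = Hom_K(Λ^q(𝔤/𝔨), V)` and `H^q(𝔤, K; V)`.  The first file of this series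
(`ChevalleyEilenbergFunctoriality`) proved the change of pair for the FULL complexes
(`isCochainMapTo_pull_top`) and, for the `(𝔤, K)`-complex, only the case of an equivariant module map
over the IDENTITY of `(𝔤, K)` (`isCochainMapTo_gK_map`, `gKCohomologyEquivOfLieModuleEquiv`).  This file adds
the TWISTED case — the change of pair along a morphism of pairs `(𝔤', K') → (𝔤, K)` covering a group
morphism `s : Γ' → Γ` of the acting groups — which is how an automorphism `σ` of `(G, K)` acts on
`(𝔤, K)`-cohomology and identifies `H^•(𝔤, K; V^σ)` of the twisted module `V^σ = V ∘ σ` with `H^•(𝔤, K; V)`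
(used downstream for the complex conjugation of `U(p, q)`, which exchanges the Hodge types `(p, q) ↔ (q, p)`,
[cite: BorelWallach2000, II §4.2]):

* §1 `pull_mem_rel`, `Subcomplex.isCochainMapTo_rel_pull` — for a compatible pair `(φ, ψ)` with
  `φ(𝔨') ⊆ 𝔨` the change of pair maps `C^•(𝔤, 𝔨; V) → C^•(𝔤', 𝔨'; V')` [cite: BorelWallach2000, I §1.2];
* §2 `PairAction.act_pull`, `pull_mem_fixed`, `pull_mem_gK`, `Subcomplex.isCochainMapTo_gK_pull` — if moreover
  `φ ∘ σ'(g') = σ(s g') ∘ φ` and `ψ ∘ τ(s g') = τ'(g') ∘ ψ` for a group morphism `s : Γ' →* Γ`, then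
  `g' • (φ,ψ)^* f = (φ,ψ)^* ((s g') • f)`, so `(φ, ψ)^*` maps `K`-fixed cochains to `K'`-fixed cochains and
  `C^•(𝔤, 𝔨, K; V) → C^•(𝔤', 𝔨', K'; V')` is a cochain map [cite: BorelWallach2000, I §5.1 (1)–(3)];
* §3 `valAct_pull`, `argDer_pull` — naturality of the argument derivation `J = argDer z`
  (`argDer z' ∘ (φ,ψ)^* = (φ,ψ)^* ∘ argDer (φ z')`), whence the transfer of `J`-weight spaces:
  `pull_mem_weightSub` (`φ z' = z`: weight `μ ↦ μ`), `pull_mem_weightSub_neg` (`φ z' = −z`: weight `μ ↦ −μ`),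
  `pull_mem_typeSub`, **`pull_mem_typeSub_neg`** (type `δ ↦ −δ` — the mechanism of `(p,q) ↦ (q,p)` under
  complex conjugation) [cite: BorelWallach2000, II §4.1–4.2];
* §4 **`gKCohomologyEquivOfPull`** — two compatible changes of pair `(φ, ψ, s)`, `(φ', ψ', s')` inverse to
  each other induce inverse isomorphisms `H^q(𝔤, 𝔨, K; V) ≃ₗ[R] H^q(𝔤', 𝔨', K'; V')`
  [cite: BorelWallach2000, I §5.1 (4)]; `gKCohomologyEquivOfPull_apply`, `…_toCohomology`,
  and `…_smul` (linearity over a second scalar ring `A`, e.g. `ℂ` over `R = ℝ`).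

Everything is over an arbitrary commutative ring `R` (the weight statements over a field `A` acting on the
values, as in `ChevalleyEilenbergBigrading`).  NOT here: any concrete group; the analytic `(𝔤, K)`-modules.

## Mathlib / Literature search

`pull`, `pull_apply`, `ins_pull`, `lieDer_pull`, `d_pull`, `pull_pull`, `pull_id`, `PairAction.act`,
`Subcomplex.gK`, `Subcomplex.mem_gK_iff`, `Subcomplex.mem_rel_zero_iff`, `Subcomplex.mem_rel_succ_iff`,
`IsCochainMapTo`, `IsCochainMapTo.cohomologyEquiv`, `IsCochainMapTo.cohomologyMap_smul`, `argDer_apply`,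
`mem_weightSub_iff`, `mem_typeSub_iff` are the tree's (`ChevalleyEilenberg{Complex,Functoriality,DirectSum,
Scalars,Bigrading}`); the `σ = id` special case is `gKCohomologyEquivOfLieModuleEquiv` (`…DirectSum`).  No twisted
change of pair for the relative / `(𝔤, K)`-complexes existed (`lean search 'isCochainMapTo_.*pull'`: only `_top`).

## References

* A. Borel, N. Wallach, *Continuous cohomology, discrete subgroups, and representations of reductive groups*,
  2nd ed., Math. Surveys Monogr. 67, AMS (2000), I §1.1–1.2, §5.1 (1)–(4); II §4.1–4.2 (held). [BorelWallach2000]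
-/

open Fin Function

namespace Literature.Algebra.Lie

namespace ChevalleyEilenberg

variable {R : Type*} [CommRing R] {L : Type*} [LieRing L] [LieAlgebra R L]
  {M : Type*} [AddCommGroup M] [Module R M] [LieRingModule L M]
  {L' : Type*} [LieRing L'] [LieAlgebra R L'] {M' : Type*} [AddCommGroup M'] [Module R M']
  [LieRingModule L' M']

/-! ## §1 The relative complex under a compatible change of Lie pair -/

section RelPull

variable [LieModule R L M] [LieModule R L' M']

/-- **A compatible change of pair `(φ, ψ)` with `φ(𝔨') ⊆ 𝔨` maps relative cochains to relative cochains**: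
`i_{x'} (φ,ψ)^* f = (φ,ψ)^* i_{φ x'} f = 0` and `θ_{x'} (φ,ψ)^* f = (φ,ψ)^* θ_{φ x'} f = 0` for `x' ∈ 𝔨'`.
[cite: BorelWallach2000, I §1.2] -/
theorem pull_mem_rel {φ : L' →ₗ⁅R⁆ L} {ψ : M →ₗ[R] M'} (hc : Compatible φ ψ)
    {K : LieSubalgebra R L} {K' : LieSubalgebra R L'} (hK : ∀ x' ∈ K', φ x' ∈ K) (q : ℕ)
    (f : Cochain R L M q) (hf : f ∈ (Subcomplex.rel R L M K).carrier q) :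
    pull M L' φ ψ q f ∈ (Subcomplex.rel R L' M' K').carrier q := by
  cases q with
  | zero =>
    rw [Subcomplex.mem_rel_zero_iff] at hf ⊢
    intro x' hx'
    rw [lieDer_pull hc, hf (φ x') (hK x' hx'), map_zero]
  | succ q =>
    rw [Subcomplex.mem_rel_succ_iff] at hf ⊢
    intro x' hx'
    refine ⟨?_, ?_⟩
    · rw [lieDer_pull hc, (hf (φ x') (hK x' hx')).1, map_zero]
    · rw [ins_pull, (hf (φ x') (hK x' hx')).2, map_zero]

/-- **The change of pair is a cochain map of relative complexes** `C^•(𝔤, 𝔨; V) → C^•(𝔤', 𝔨'; V')`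
(`φ(𝔨') ⊆ 𝔨`; e.g. the restriction to a subpair, or an automorphism of `(𝔤, 𝔨)`).
[cite: BorelWallach2000, I §1.2] -/
theorem Subcomplex.isCochainMapTo_rel_pull {φ : L' →ₗ⁅R⁆ L} {ψ : M →ₗ[R] M'} (hc : Compatible φ ψ)
    {K : LieSubalgebra R L} {K' : LieSubalgebra R L'} (hK : ∀ x' ∈ K', φ x' ∈ K) :
    (Subcomplex.rel R L M K).IsCochainMapTo (Subcomplex.rel R L' M' K') (pull M L' φ ψ) :=
  ⟨fun q f => d_pull hc q f, fun q f hf => pull_mem_rel hc hK q f hf⟩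

end RelPull

/-! ## §2 The `(𝔤, K)`-complex under a change of pair covering a group morphism -/

section GKPull

variable {Γ : Type*} [Group Γ] {Γ' : Type*} [Group Γ']

/-- **The group actions on cochains under a twisted change of pair**: if `φ ∘ σ'(g') = σ(s g') ∘ φ` and
`ψ ∘ τ(s g') = τ'(g') ∘ ψ`, then `g' • (φ,ψ)^* f = (φ,ψ)^* ((s g') • f)`.
[cite: BorelWallach2000, I §5.1 (1)] -/
theorem PairAction.act_pull (A : PairAction R L M Γ) (A' : PairAction R L' M' Γ') (φ : L' →ₗ⁅R⁆ L)
    (ψ : M →ₗ[R] M') (s : Γ' →* Γ) (hσ : ∀ (g' : Γ') (x' : L'), φ (A'.σ g' x') = A.σ (s g') (φ x'))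
    (hτ : ∀ (g' : Γ') (m : M), ψ (A.τ (s g') m) = A'.τ g' (ψ m)) (g' : Γ') (q : ℕ) (f : Cochain R L M q) :
    A'.act g' q (pull M L' φ ψ q f) = pull M L' φ ψ q (A.act (s g') q f) := by
  ext v
  have h : (φ ∘ fun i => A'.σ g'⁻¹ (v i)) = fun i => A.σ (s g')⁻¹ ((φ ∘ v) i) := by
    funext i
    simp only [Function.comp_apply, hσ, map_inv]
  simp only [PairAction.act_apply, pull_apply]
  rw [h, hτ]

/-- `(φ, ψ)^*` maps `Γ`-fixed cochains to `Γ'`-fixed cochains. [cite: BorelWallach2000, I §5.1 (3)] -/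
theorem pull_mem_fixed (A : PairAction R L M Γ) (A' : PairAction R L' M' Γ') (φ : L' →ₗ⁅R⁆ L)
    (ψ : M →ₗ[R] M') (s : Γ' →* Γ) (hσ : ∀ (g' : Γ') (x' : L'), φ (A'.σ g' x') = A.σ (s g') (φ x'))
    (hτ : ∀ (g' : Γ') (m : M), ψ (A.τ (s g') m) = A'.τ g' (ψ m)) (q : ℕ) (f : Cochain R L M q)
    (hf : f ∈ A.fixed q) : pull M L' φ ψ q f ∈ A'.fixed q := by
  rw [PairAction.mem_fixed_iff] at hf ⊢
  intro g'
  rw [PairAction.act_pull A A' φ ψ s hσ hτ, hf (s g')]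

variable [LieModule R L M] [LieModule R L' M']

/-- `(φ, ψ)^*` maps `C^q(𝔤, 𝔨, K; V)` into `C^q(𝔤', 𝔨', K'; V')`. [cite: BorelWallach2000, I §5.1 (1)–(3)] -/
theorem pull_mem_gK {φ : L' →ₗ⁅R⁆ L} {ψ : M →ₗ[R] M'} (hc : Compatible φ ψ)
    {K : LieSubalgebra R L} {K' : LieSubalgebra R L'} (hK : ∀ x' ∈ K', φ x' ∈ K)
    (A : PairAction R L M Γ) (A' : PairAction R L' M' Γ') (s : Γ' →* Γ)
    (hσ : ∀ (g' : Γ') (x' : L'), φ (A'.σ g' x') = A.σ (s g') (φ x'))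
    (hτ : ∀ (g' : Γ') (m : M), ψ (A.τ (s g') m) = A'.τ g' (ψ m)) (q : ℕ) (f : Cochain R L M q)
    (hf : f ∈ (Subcomplex.gK R L M K A).carrier q) :
    pull M L' φ ψ q f ∈ (Subcomplex.gK R L' M' K' A').carrier q := by
  rw [Subcomplex.mem_gK_iff] at hf ⊢
  refine ⟨pull_mem_rel hc hK q f hf.1, fun g' => ?_⟩
  rw [PairAction.act_pull A A' φ ψ s hσ hτ, hf.2 (s g')]

/-- **Twisted functoriality of the `(𝔤, K)`-complex**: a compatible change of pair `(φ, ψ)` with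
`φ(𝔨') ⊆ 𝔨`, covering a group morphism `s : K' → K` (`φ ∘ Ad'(k') = Ad(s k') ∘ φ`, `ψ ∘ π(s k') = π'(k') ∘ ψ`),
is a cochain map `C^•(𝔤, 𝔨, K; V) → C^•(𝔤', 𝔨', K'; V')`.  For `(φ, s) = (dσ, σ|_K)` an automorphism of
`(G, K)` and `ψ = id : V^σ → V` … `V`, this is the action of `σ` on `(𝔤, K)`-cochains.
[cite: BorelWallach2000, I §5.1 (1)–(3)] -/
theorem Subcomplex.isCochainMapTo_gK_pull {φ : L' →ₗ⁅R⁆ L} {ψ : M →ₗ[R] M'} (hc : Compatible φ ψ)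
    {K : LieSubalgebra R L} {K' : LieSubalgebra R L'} (hK : ∀ x' ∈ K', φ x' ∈ K)
    (A : PairAction R L M Γ) (A' : PairAction R L' M' Γ') (s : Γ' →* Γ)
    (hσ : ∀ (g' : Γ') (x' : L'), φ (A'.σ g' x') = A.σ (s g') (φ x'))
    (hτ : ∀ (g' : Γ') (m : M), ψ (A.τ (s g') m) = A'.τ g' (ψ m)) :
    (Subcomplex.gK R L M K A).IsCochainMapTo (Subcomplex.gK R L' M' K' A') (pull M L' φ ψ) :=
  ⟨fun q f => d_pull hc q f, fun q f hf => pull_mem_gK hc hK A A' s hσ hτ q f hf⟩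

end GKPull

/-! ## §3 The argument derivation and the `J`-types under a change of pair -/

section ArgDerPull

variable [LieModule R L M] [LieModule R L' M']

/-- The action on values is natural: `valAct z' ((φ,ψ)^* f) = (φ,ψ)^* (valAct (φ z') f)` (the compatibility
`ψ(φ(x')·v) = x'·ψ(v)` of the change of pair, valuewise). [cite: BorelWallach2000, I §1.1] -/
theorem valAct_pull {φ : L' →ₗ⁅R⁆ L} {ψ : M →ₗ[R] M'} (hc : Compatible φ ψ) (z' : L') (q : ℕ)
    (f : Cochain R L M q) :
    valAct R L' M' q z' (pull M L' φ ψ q f) = pull M L' φ ψ q (valAct R L M q (φ z') f) := by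
  ext v
  simp only [valAct_apply, pull_apply]
  exact (hc z' (f (φ ∘ v))).symm

/-- **`J` is natural under compatible changes of pair**: `argDer z' ∘ (φ,ψ)^* = (φ,ψ)^* ∘ argDer (φ z')`.
[cite: BorelWallach2000, II §4.1] -/
theorem argDer_pull {φ : L' →ₗ⁅R⁆ L} {ψ : M →ₗ[R] M'} (hc : Compatible φ ψ) (z' : L') (q : ℕ)
    (f : Cochain R L M q) :
    argDer M' z' q (pull M L' φ ψ q f) = pull M L' φ ψ q (argDer M (φ z') q f) := by
  rw [argDer_apply, argDer_apply, valAct_pull hc, lieDer_pull hc, map_sub]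

/-- `argDer` is additive-inverse in the element: `argDer (−z) = −argDer z`. [cite: BorelWallach2000, II §4.1] -/
theorem argDer_neg (z : L) (q : ℕ) (f : Cochain R L M q) : argDer M (-z) q f = -argDer M z q f := by
  rw [argDer_apply, argDer_apply, map_neg, map_neg, LinearMap.neg_apply, LinearMap.neg_apply, neg_sub_neg,
    neg_sub]

variable {A : Type*} [Field A] [Module A M] [SMulCommClass R A M] [Module A M'] [SMulCommClass R A M']

/-- **Transfer of `J`-weights, same element**: if `φ z' = z`, `ψ` is `A`-linear and `(φ,ψ)^*` maps the family `S`
into the family `T`, then `(φ,ψ)^*` maps the `z`-weight-`μ` cochains of `S` to the `z'`-weight-`μ` cochains of `T`.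
[cite: BorelWallach2000, II §4.2 (3)] -/
theorem pull_mem_weightSub {φ : L' →ₗ⁅R⁆ L} {ψ : M →ₗ[R] M'} (hc : Compatible φ ψ)
    (hψ : ∀ (a : A) (m : M), ψ (a • m) = a • ψ m)
    {S : (q : ℕ) → Submodule R (Cochain R L M q)} {T : (q : ℕ) → Submodule R (Cochain R L' M' q)}
    (hST : ∀ (q : ℕ) (f : Cochain R L M q), f ∈ S q → pull M L' φ ψ q f ∈ T q)
    {z : L} {z' : L'} (hz : φ z' = z) (μ : A) (q : ℕ) {f : Cochain R L M q} (hf : f ∈ weightSub S z μ q) :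
    pull M L' φ ψ q f ∈ weightSub T z' μ q := by
  rw [mem_weightSub_iff] at hf ⊢
  refine ⟨hST q f hf.1, ?_⟩
  rw [argDer_pull hc, hz, hf.2]
  ext v
  simp only [pull_apply, AlternatingMap.smul_apply, hψ]

/-- **Transfer of `J`-weights, opposite element**: if `φ z' = −z` (e.g. complex conjugation on `𝔲(p,q)`,
`z₀ ↦ −z₀`), then `(φ,ψ)^*` maps `z`-weight `μ` to `z'`-weight `−μ`. [cite: BorelWallach2000, II §4.2 (3)] -/
theorem pull_mem_weightSub_neg {φ : L' →ₗ⁅R⁆ L} {ψ : M →ₗ[R] M'} (hc : Compatible φ ψ)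
    (hψ : ∀ (a : A) (m : M), ψ (a • m) = a • ψ m)
    {S : (q : ℕ) → Submodule R (Cochain R L M q)} {T : (q : ℕ) → Submodule R (Cochain R L' M' q)}
    (hST : ∀ (q : ℕ) (f : Cochain R L M q), f ∈ S q → pull M L' φ ψ q f ∈ T q)
    {z : L} {z' : L'} (hz : φ z' = -z) (μ : A) (q : ℕ) {f : Cochain R L M q} (hf : f ∈ weightSub S z μ q) :
    pull M L' φ ψ q f ∈ weightSub T z' (-μ) q := by
  rw [mem_weightSub_iff] at hf ⊢
  refine ⟨hST q f hf.1, ?_⟩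
  rw [argDer_pull hc, hz, argDer_neg, hf.2, map_neg, neg_smul]
  congr 1
  ext v
  simp only [pull_apply, AlternatingMap.smul_apply, hψ]

/-- Transfer of types `S^n_δ → T^n_δ` when `φ z' = z`. [cite: BorelWallach2000, II §4.2 (3)] -/
theorem pull_mem_typeSub {φ : L' →ₗ⁅R⁆ L} {ψ : M →ₗ[R] M'} (hc : Compatible φ ψ)
    (hψ : ∀ (a : A) (m : M), ψ (a • m) = a • ψ m)
    {S : (q : ℕ) → Submodule R (Cochain R L M q)} {T : (q : ℕ) → Submodule R (Cochain R L' M' q)}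
    (hST : ∀ (q : ℕ) (f : Cochain R L M q), f ∈ S q → pull M L' φ ψ q f ∈ T q)
    {z : L} {z' : L'} (hz : φ z' = z) (I : A) (n : ℕ) (δ : ℤ) {f : Cochain R L M n}
    (hf : f ∈ typeSub S z I n δ) : pull M L' φ ψ n f ∈ typeSub T z' I n δ :=
  (mem_typeSub_iff _ _ _ _ _ _).2
    ((mem_weightSub_iff _ _ _ _ _).1
      (pull_mem_weightSub hc hψ hST hz ((δ : A) * I) n ((mem_typeSub_iff _ _ _ _ _ _).1 hf)))

/-- **Transfer of types `S^n_δ → T^n_{−δ}` when `φ z' = −z`**: a change of pair reversing the complex-structure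
element exchanges the types `(p, q) ↔ (q, p)` ("`𝔭⁻` and `𝔭⁺` are complex conjugates of each other").
[cite: BorelWallach2000, II §4.2] -/
theorem pull_mem_typeSub_neg {φ : L' →ₗ⁅R⁆ L} {ψ : M →ₗ[R] M'} (hc : Compatible φ ψ)
    (hψ : ∀ (a : A) (m : M), ψ (a • m) = a • ψ m)
    {S : (q : ℕ) → Submodule R (Cochain R L M q)} {T : (q : ℕ) → Submodule R (Cochain R L' M' q)}
    (hST : ∀ (q : ℕ) (f : Cochain R L M q), f ∈ S q → pull M L' φ ψ q f ∈ T q)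
    {z : L} {z' : L'} (hz : φ z' = -z) (I : A) (n : ℕ) (δ : ℤ) {f : Cochain R L M n}
    (hf : f ∈ typeSub S z I n δ) : pull M L' φ ψ n f ∈ typeSub T z' I n (-δ) := by
  rw [mem_typeSub_iff, Int.cast_neg, neg_mul]
  exact (mem_weightSub_iff _ _ _ _ _).1
    (pull_mem_weightSub_neg hc hψ hST hz ((δ : A) * I) n ((mem_typeSub_iff _ _ _ _ _ _).1 hf))

end ArgDerPull

/-! ## §4 Inverse twists induce an isomorphism of `(𝔤, K)`-cohomology -/

section Equiv

variable [LieModule R L M] [LieModule R L' M'] {Γ : Type*} [Group Γ] {Γ' : Type*} [Group Γ']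
  {φ : L' →ₗ⁅R⁆ L} {ψ : M →ₗ[R] M'} {φ' : L →ₗ⁅R⁆ L'} {ψ' : M' →ₗ[R] M}

omit [LieRingModule L M] [LieRingModule L' M'] [LieModule R L M] [LieModule R L' M'] in
/-- Inverse changes of pair compose to the identity on cochains (`(φ ∘ φ', ψ' ∘ ψ)^* = (id, id)^* = id`).
[cite: BorelWallach2000, I §1.1] -/
theorem pull_pull_eq_self (hφ : ∀ x : L, φ (φ' x) = x) (hψ : ∀ m : M, ψ' (ψ m) = m) (q : ℕ)
    (f : Cochain R L M q) : pull M' L φ' ψ' q (pull M L' φ ψ q f) = f := by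
  ext v
  simp only [pull_apply, Function.comp_def, hφ, hψ]

variable {K : LieSubalgebra R L} {K' : LieSubalgebra R L'} {A : PairAction R L M Γ} {A' : PairAction R L' M' Γ'}
  {s : Γ' →* Γ} {s' : Γ →* Γ'}

/-- **Inverse twisted changes of pair induce an isomorphism `H^q(𝔤, 𝔨, K; V) ≃ H^q(𝔤', 𝔨', K'; V')`.**
Data: compatible pairs `(φ, ψ) : (𝔤', V) ⇄ (𝔤, V') : (φ', ψ')` inverse to each other, with `φ(𝔨') ⊆ 𝔨`,
`φ'(𝔨) ⊆ 𝔨'`, covering group morphisms `s : K' → K`, `s' : K → K'` that intertwine the pair actions.  For an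
automorphism `σ` of `(G, K)` and the twisted module `V^σ` this is `H^q(𝔤, K; V) ≅ H^q(𝔤, K; V^σ)`.
[cite: BorelWallach2000, I §5.1 (4)] -/
noncomputable def gKCohomologyEquivOfPull (hc : Compatible φ ψ) (hc' : Compatible φ' ψ')
    (hK : ∀ x' ∈ K', φ x' ∈ K) (hK' : ∀ x ∈ K, φ' x ∈ K')
    (hσ : ∀ (g' : Γ') (x' : L'), φ (A'.σ g' x') = A.σ (s g') (φ x'))
    (hτ : ∀ (g' : Γ') (m : M), ψ (A.τ (s g') m) = A'.τ g' (ψ m))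
    (hσ' : ∀ (g : Γ) (x : L), φ' (A.σ g x) = A'.σ (s' g) (φ' x))
    (hτ' : ∀ (g : Γ) (m' : M'), ψ' (A'.τ (s' g) m') = A.τ g (ψ' m'))
    (hφ : ∀ x : L, φ (φ' x) = x) (hφ' : ∀ x' : L', φ' (φ x') = x')
    (hψ : ∀ m : M, ψ' (ψ m) = m) (hψ' : ∀ m' : M', ψ (ψ' m') = m') (q : ℕ) :
    gKCohomology R L M K A q ≃ₗ[R] gKCohomology R L' M' K' A' q :=
  (Subcomplex.isCochainMapTo_gK_pull hc hK A A' s hσ hτ).cohomologyEquiv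
    (Subcomplex.isCochainMapTo_gK_pull hc' hK' A' A s' hσ' hτ')
    (fun q f _ => pull_pull_eq_self hφ hψ q f) (fun q f _ => pull_pull_eq_self hφ' hψ' q f) q

/-- The isomorphism is the map induced by `(φ, ψ)^*`. [cite: BorelWallach2000, I §5.1 (4)] -/
theorem gKCohomologyEquivOfPull_apply (hc : Compatible φ ψ) (hc' : Compatible φ' ψ')
    (hK : ∀ x' ∈ K', φ x' ∈ K) (hK' : ∀ x ∈ K, φ' x ∈ K')
    (hσ : ∀ (g' : Γ') (x' : L'), φ (A'.σ g' x') = A.σ (s g') (φ x'))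
    (hτ : ∀ (g' : Γ') (m : M), ψ (A.τ (s g') m) = A'.τ g' (ψ m))
    (hσ' : ∀ (g : Γ) (x : L), φ' (A.σ g x) = A'.σ (s' g) (φ' x))
    (hτ' : ∀ (g : Γ) (m' : M'), ψ' (A'.τ (s' g) m') = A.τ g (ψ' m'))
    (hφ : ∀ x : L, φ (φ' x) = x) (hφ' : ∀ x' : L', φ' (φ x') = x')
    (hψ : ∀ m : M, ψ' (ψ m) = m) (hψ' : ∀ m' : M', ψ (ψ' m') = m') (q : ℕ)
    (x : gKCohomology R L M K A q) :
    gKCohomologyEquivOfPull hc hc' hK hK' hσ hτ hσ' hτ' hφ hφ' hψ hψ' q x =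
      (Subcomplex.isCochainMapTo_gK_pull hc hK A A' s hσ hτ).cohomologyMap q x := rfl

/-- On classes: `[z] ↦ [(φ, ψ)^* z]`. [cite: BorelWallach2000, I §5.1 (4)] -/
theorem gKCohomologyEquivOfPull_toCohomology (hc : Compatible φ ψ) (hc' : Compatible φ' ψ')
    (hK : ∀ x' ∈ K', φ x' ∈ K) (hK' : ∀ x ∈ K, φ' x ∈ K')
    (hσ : ∀ (g' : Γ') (x' : L'), φ (A'.σ g' x') = A.σ (s g') (φ x'))
    (hτ : ∀ (g' : Γ') (m : M), ψ (A.τ (s g') m) = A'.τ g' (ψ m))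
    (hσ' : ∀ (g : Γ) (x : L), φ' (A.σ g x) = A'.σ (s' g) (φ' x))
    (hτ' : ∀ (g : Γ) (m' : M'), ψ' (A'.τ (s' g) m') = A.τ g (ψ' m'))
    (hφ : ∀ x : L, φ (φ' x) = x) (hφ' : ∀ x' : L', φ' (φ x') = x')
    (hψ : ∀ m : M, ψ' (ψ m) = m) (hψ' : ∀ m' : M', ψ (ψ' m') = m') (q : ℕ)
    (z : (Subcomplex.gK R L M K A).cocycles q) :
    gKCohomologyEquivOfPull hc hc' hK hK' hσ hτ hσ' hτ' hφ hφ' hψ hψ' q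
        ((Subcomplex.gK R L M K A).toCohomology q z) =
      (Subcomplex.gK R L' M' K' A').toCohomology q
        ⟨pull M L' φ ψ q z, (Subcomplex.isCochainMapTo_gK_pull hc hK A A' s hσ hτ).mapsTo_cocycles q _ z.2⟩ :=
  rfl

variable {B : Type*} [CommRing B] [Module B M] [SMulCommClass R B M] [LieSMulComm B L M]
  [Module B M'] [SMulCommClass R B M'] [LieSMulComm B L' M'] [A.SMulComm B] [A'.SMulComm B]

/-- **The isomorphism is linear for a second ring of scalars `B` acting on the values** (e.g. `ℂ` when
`R = ℝ`), provided `ψ` is `B`-linear. [cite: BorelWallach2000, I §5.1 (1), (4)] -/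
theorem gKCohomologyEquivOfPull_smul (hc : Compatible φ ψ) (hc' : Compatible φ' ψ')
    (hK : ∀ x' ∈ K', φ x' ∈ K) (hK' : ∀ x ∈ K, φ' x ∈ K')
    (hσ : ∀ (g' : Γ') (x' : L'), φ (A'.σ g' x') = A.σ (s g') (φ x'))
    (hτ : ∀ (g' : Γ') (m : M), ψ (A.τ (s g') m) = A'.τ g' (ψ m))
    (hσ' : ∀ (g : Γ) (x : L), φ' (A.σ g x) = A'.σ (s' g) (φ' x))
    (hτ' : ∀ (g : Γ) (m' : M'), ψ' (A'.τ (s' g) m') = A.τ g (ψ' m'))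
    (hφ : ∀ x : L, φ (φ' x) = x) (hφ' : ∀ x' : L', φ' (φ x') = x')
    (hψ : ∀ m : M, ψ' (ψ m) = m) (hψ' : ∀ m' : M', ψ (ψ' m') = m')
    (hψB : ∀ (b : B) (m : M), ψ (b • m) = b • ψ m) (q : ℕ) (b : B) (x : gKCohomology R L M K A q) :
    gKCohomologyEquivOfPull hc hc' hK hK' hσ hτ hσ' hτ' hφ hφ' hψ hψ' q (b • x) =
      b • gKCohomologyEquivOfPull hc hc' hK hK' hσ hτ hσ' hτ' hφ hφ' hψ hψ' q x :=
  (Subcomplex.isCochainMapTo_gK_pull hc hK A A' s hσ hτ).cohomologyMap_smul _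
    (fun q b f => AlternatingMap.ext fun v => by simp only [pull_apply, AlternatingMap.smul_apply, hψB]) q b x

end Equiv

end ChevalleyEilenberg

end Literature.Algebra.Lie
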